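import Mathlib.Analysis.InnerProductSpace.PiL2
import Mathlib.Analysis.Complex.Exponential
import Mathlib.LinearAlgebra.Matrix.Block
import Mathlib.LinearAlgebra.Matrix.NonsingularInverse
import Mathlib.Algebra.BigOperators.Module
import Mathlib.Data.Fintype.BigOperators
import Mathlib.Data.Fin.SuccPred
import Literature.Analysis.InnerProduct.GramHadamard
import HarnessLib

/-!
# The weighted-torus TPP triple `(T_c U⁻, U⁺, O(n))` in `GL_n(ℝ)` — every `n` (finite Lie exponent of `SL(n,ℝ)`)

Blasiak–Cohn–Grochow–Pratt–Umans (*Matrix multiplication via matrix groups*, arXiv:2204.03826,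
Def. 4.1, §5) define the Lie exponent of a Lie group through triples of submanifolds with the
triple product property (TPP) and ask "whether the Lie exponent of `SL(n,ℝ)` is even finite".
For subgroups `H₁, H₂, H₃ ≤ G` the TPP reads: `h₁ h₂ h₃ = 1` with `hᵢ ∈ Hᵢ` forces
`h₁ = h₂ = h₃ = 1` (and it is invariant under permuting the three subgroups: conjugate a cyclic
shift, invert a reversal).

**Theorem** (`soloLie_tpp_weightedTorus`, all `n`).  Fix a strictly decreasing weight
`c : Fin n → ℝ`.  Let `v` be unit lower triangular, `u` unit upper triangular, `x : Fin n → ℝ` with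
the single torus relation `∑ cᵢ xᵢ = 0`, and `k` real orthogonal (`kᵀ k = 1`).  If
`v · diag(exp xᵢ) · u · k = 1` then `v = 1`, `x = 0`, `u = 1`, `k = 1`.

The set `{v · diag(exp x) : v ∈ U⁻, ∑ cᵢxᵢ = 0}` is the closed connected subgroup `T_c·U⁻ = U⁻·T_c`
(`T_c` = the kernel of the character `diag(eˣ) ↦ ∑ cᵢxᵢ` on the positive diagonal torus,
dimension `n − 1`; it normalises `U⁻`), so the theorem is the TPP for the subgroup triple
`(T_c U⁻, U⁺, O(n))`, hence for `(SO(n), U⁺, T_c U⁻)`, of dimensions `N + n − 1, N, N` with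
`N = n(n−1)/2`.  With `dim GL_n(ℝ) = n²`, rank `n`, Definition 4.1 of BCGPU gives Lie exponent
`ω(GL(n,ℝ)) ≤ n / ((3N + n − 1)/3 − N) = 3n/(n−1)`, and (intersecting `T_c` with `SL_n`, one
dimension less) `ω(SL(n,ℝ)) ≤ 3(n−1)/(n−2)` for `n ≥ 3` — finite, answering the quoted question.
The kernel instance `n = 3` (weights `(2,1,0)`) is the tree's `soloLie_tpp_weightedTorus_fin_three`
(`SoloBlindWeightedTorusTPP` supersedes it for every `n` and every strictly decreasing `c`).

Proof (Gauss cell + Hadamard + Abel).  `Q := v·D·u = kᵀ` is orthogonal.  (1) The leading `j × j`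
block of `v D u` is `v_{≤j} D_{≤j} u_{≤j}` (`soloLie_submatrix_vdu`), so its determinant is
`∏_{i<j} exp xᵢ = exp(x₀ + ⋯ + x_{j−1})` (`soloLie_det_submatrix_vdu`).  (2) A `j × j` minor of an
orthogonal matrix has modulus `≤ 1` (`soloLie_abs_det_submatrix_le_one`): it is the Gram-type
determinant `det ⟪e_a, Q e_b⟫` of unit vectors, bounded by the tree's Gram–Hadamard inequality
`Literature.Analysis.InnerProduct.norm_det_inner_le_prod_norm_mul_prod_norm`.  Hence every partial
sum `x₀ + ⋯ + x_{j−1} ≤ 0`, and the full sum is `0` (`det Q = ±1`).  (3) Abel summation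
(`soloLie_abel_range`): `∑ cᵢxᵢ = ∑_{j} (c_{j−1} − c_j)·(x₀+⋯+x_{j−1})` is a combination with
positive coefficients of non-positive numbers, and it vanishes, so all partial sums vanish and
`x = 0`.  (4) Then `Q = v u` is orthogonal with unit triangular factors, which forces `v = u = 1`
column by column (`soloLie_vu_orthogonal_eq_one`), and finally `k = Q⁻¹ = 1`. ∎

References: BCGPU 2022 = arXiv:2204.03826 (Def. 4.1 p.8; §5 p.12, the finiteness question);
the seat's note `paper/LieExponent.md`, Theorem 1 (pen proof, all `n`), of which this file is the
kernel form.
-/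

namespace Summit.MatrixMultiplication.MatrixMultiplication.Theorems

set_option linter.dupNamespace false

open Matrix Finset
open scoped InnerProductSpace

/-! ### 1. Abel summation: a vanishing positive combination of non-positive partial sums -/

/-- Abel step (over `ℕ`): if `c` is strictly decreasing on `[0,n)`, the partial sums
`x₀ + ⋯ + x_{m−1}` (`m < n`) are `≤ 0`, the full sum vanishes and `∑_{i<n} cᵢ xᵢ = 0`, then
`xᵢ = 0` for all `i < n`. [new] -/
theorem soloLie_abel_range (n : ℕ) (c x : ℕ → ℝ)
    (hc : ∀ i, i + 1 < n → c (i + 1) < c i)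
    (hP : ∀ m, m < n → ∑ i ∈ range m, x i ≤ 0)
    (hPn : ∑ i ∈ range n, x i = 0)
    (hcx : ∑ i ∈ range n, c i * x i = 0) :
    ∀ i, i < n → x i = 0 := by
  have hparts := Finset.sum_range_by_parts c x n
  simp only [smul_eq_mul] at hparts
  rw [hcx, hPn, mul_zero, zero_sub] at hparts
  have hsum : ∑ i ∈ range (n - 1), (c (i + 1) - c i) * ∑ j ∈ range (i + 1), x j = 0 := by
    linarith
  have hnonneg : ∀ i ∈ range (n - 1), 0 ≤ (c (i + 1) - c i) * ∑ j ∈ range (i + 1), x j := by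
    intro i hi
    have hi' : i + 1 < n := by
      have := Finset.mem_range.1 hi
      omega
    have h1 := hc i hi'
    have h2 := hP (i + 1) hi'
    nlinarith
  have hzero := (Finset.sum_eq_zero_iff_of_nonneg hnonneg).1 hsum
  have hPm : ∀ m, m ≤ n → ∑ j ∈ range m, x j = 0 := by
    intro m hm
    rcases Nat.eq_zero_or_pos m with h0 | hpos
    · simp [h0]
    · by_cases hmn : m = n
      · rw [hmn]; exact hPn
      · have hlt : m < n := lt_of_le_of_ne hm hmn
        have hmem : m - 1 ∈ range (n - 1) := by
          rw [Finset.mem_range]; omega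
        have h := hzero (m - 1) hmem
        have hm1 : m - 1 + 1 = m := by omega
        rw [hm1] at h
        have hclt := hc (m - 1) (by omega)
        rw [hm1] at hclt
        have hcne : c m - c (m - 1) ≠ 0 := (by linarith : c m - c (m - 1) < 0).ne
        rcases mul_eq_zero.1 h with h1 | h2
        · exact absurd h1 hcne
        · exact h2
  intro i hi
  have h1 := hPm (i + 1) (by omega)
  have h2 := hPm i (by omega)
  rw [Finset.sum_range_succ, h2, zero_add] at h1
  exact h1

/-! ### 2. The leading blocks of `v · D · u` (Gauss cell) -/

/-- For `v` lower triangular, the leading `j × j` block of `v · diag δ · u` is the product of the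
leading blocks. [folklore] -/
theorem soloLie_submatrix_vdu {n j : ℕ} (hj : j ≤ n) (v u : Matrix (Fin n) (Fin n) ℝ)
    (δ : Fin n → ℝ) (hv : ∀ i k : Fin n, i < k → v i k = 0) :
    (v * diagonal δ * u).submatrix (Fin.castLE hj) (Fin.castLE hj) =
      (v.submatrix (Fin.castLE hj) (Fin.castLE hj)) * diagonal (δ ∘ Fin.castLE hj) *
        (u.submatrix (Fin.castLE hj) (Fin.castLE hj)) := by
  have hvD : v * diagonal δ = of fun i m => v i m * δ m := by
    ext i m; exact mul_diagonal δ v i m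
  have hvD' : (v.submatrix (Fin.castLE hj) (Fin.castLE hj)) * diagonal (δ ∘ Fin.castLE hj) =
      of fun a m => v (Fin.castLE hj a) (Fin.castLE hj m) * δ (Fin.castLE hj m) := by
    ext a m; exact mul_diagonal (δ ∘ Fin.castLE hj) _ a m
  rw [hvD, hvD']
  ext a b
  simp only [submatrix_apply, mul_apply, of_apply]
  symm
  refine Finset.sum_of_injOn (Fin.castLE hj) (Fin.castLE_injective hj).injOn
    (fun _ _ => by simp) ?_ (fun _ _ => rfl)
  intro m _ hm
  have hjm : j ≤ (m : ℕ) := by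
    rcases Nat.lt_or_ge (m : ℕ) j with hlt | hge
    · exact absurd ⟨⟨m, hlt⟩, by simp, Fin.ext rfl⟩ hm
    · exact hge
  have hlt : Fin.castLE hj a < m := by
    rw [Fin.lt_def, Fin.val_castLE]
    exact lt_of_lt_of_le a.isLt hjm
  rw [hv _ _ hlt, zero_mul, zero_mul]

/-- The leading `j × j` minor of `v · diag δ · u` (`v` unit lower, `u` unit upper triangular) is
`∏_{i<j} δᵢ`. [folklore] -/
theorem soloLie_det_submatrix_vdu {n j : ℕ} (hj : j ≤ n) (v u : Matrix (Fin n) (Fin n) ℝ)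
    (δ : Fin n → ℝ) (hvd : ∀ i, v i i = 1) (hv : ∀ i k : Fin n, i < k → v i k = 0)
    (hud : ∀ i, u i i = 1) (hu : ∀ i k : Fin n, k < i → u i k = 0) :
    ((v * diagonal δ * u).submatrix (Fin.castLE hj) (Fin.castLE hj)).det =
      ∏ i : Fin j, δ (Fin.castLE hj i) := by
  rw [soloLie_submatrix_vdu hj v u δ hv, det_mul, det_mul, det_diagonal]
  have h1 : (v.submatrix (Fin.castLE hj) (Fin.castLE hj)).det = 1 := by
    rw [Matrix.det_of_lowerTriangular _ ?_]
    · simp [hvd]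
    · intro a b hab
      exact hv _ _ (Fin.strictMono_castLE hj (OrderDual.toDual_lt_toDual.mp hab))
  have h2 : (u.submatrix (Fin.castLE hj) (Fin.castLE hj)).det = 1 := by
    rw [Matrix.det_of_upperTriangular ?_]
    · simp [hud]
    · intro a b hab
      exact hu _ _ (Fin.strictMono_castLE hj hab)
  rw [h1, h2, one_mul, mul_one]
  rfl

/-! ### 3. Minors of an orthogonal matrix (Gram–Hadamard) -/

/-- A leading `j × j` minor of a real orthogonal matrix has modulus `≤ 1`: it is the Gram-type
determinant `det ⟪e_a, Q e_b⟫` of unit vectors (Gram–Hadamard, tree). [folklore] -/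
theorem soloLie_abs_det_submatrix_le_one {n j : ℕ} (hj : j ≤ n) (Q : Matrix (Fin n) (Fin n) ℝ)
    (hQ : Qᵀ * Q = 1) : |(Q.submatrix (Fin.castLE hj) (Fin.castLE hj)).det| ≤ 1 := by
  let f : Fin j → EuclideanSpace ℝ (Fin n) := fun a => EuclideanSpace.single (Fin.castLE hj a) (1 : ℝ)
  let g : Fin j → EuclideanSpace ℝ (Fin n) := fun b => WithLp.toLp 2 (fun m => Q m (Fin.castLE hj b))
  have hmat : (Matrix.of fun a b => ⟪f a, g b⟫_ℝ) = Q.submatrix (Fin.castLE hj) (Fin.castLE hj) := by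
    ext a b
    simp only [Matrix.of_apply, submatrix_apply, f, g, EuclideanSpace.inner_single_left]
    simp
  have hf : ∀ a, ‖f a‖ = 1 := fun a => by simp [f, PiLp.norm_single]
  have hg : ∀ b, ‖g b‖ = 1 := by
    intro b
    have hsq : ‖g b‖ ^ 2 = 1 := by
      rw [EuclideanSpace.real_norm_sq_eq]
      have h := congrFun (congrFun hQ (Fin.castLE hj b)) (Fin.castLE hj b)
      rw [mul_apply] at h
      simp only [transpose_apply, one_apply_eq] at h
      simpa [g, PiLp.toLp_apply, pow_two] using h
    nlinarith [norm_nonneg (g b)]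
  have h := Literature.Analysis.InnerProduct.norm_det_inner_le_prod_norm_mul_prod_norm (𝕜 := ℝ) f g
  rw [hmat] at h
  simp only [hf, hg, Finset.prod_const_one, mul_one] at h
  simpa [Real.norm_eq_abs] using h

/-! ### 4. Rigidity: an orthogonal matrix with unit triangular Gauss factors is the identity -/

/-- If `v` is unit lower triangular, `u` unit upper triangular and `v · u` is orthogonal, then
`v = u = 1` (column/row `k` of `v u` is column `k` of `v` / row `k` of `u` once the earlier ones are
trivial, and it is a unit vector with a `1` on the diagonal). [folklore] -/
theorem soloLie_vu_orthogonal_eq_one {n : ℕ} (v u : Matrix (Fin n) (Fin n) ℝ)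
    (hvd : ∀ i, v i i = 1) (hv : ∀ i k : Fin n, i < k → v i k = 0)
    (hud : ∀ i, u i i = 1) (hu : ∀ i k : Fin n, k < i → u i k = 0)
    (hQ : (v * u)ᵀ * (v * u) = 1) : v = 1 ∧ u = 1 := by
  have hQ' : (v * u) * (v * u)ᵀ = 1 := mul_eq_one_comm.mp hQ
  have key : ∀ k : ℕ, ∀ κ : Fin n, (κ : ℕ) = k →
      (∀ i : Fin n, i ≠ κ → v i κ = 0) ∧ (∀ i : Fin n, i ≠ κ → u κ i = 0) := by
    intro k
    refine Nat.strong_induction_on k fun k ih => ?_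
    intro κ hκ
    have hcol : ∀ i, (v * u) i κ = v i κ := by
      intro i
      rw [mul_apply, Finset.sum_eq_single κ]
      · rw [hud, mul_one]
      · intro m _ hm
        rcases lt_or_gt_of_ne hm with h | h
        · have hmk : (m : ℕ) < k := by rw [← hκ]; exact h
          rw [(ih m hmk m rfl).2 κ (Ne.symm hm), mul_zero]
        · rw [hu m κ h, mul_zero]
      · intro h; exact absurd (Finset.mem_univ κ) h
    have hrow : ∀ i, (v * u) κ i = u κ i := by
      intro i
      rw [mul_apply, Finset.sum_eq_single κ]
      · rw [hvd, one_mul]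
      · intro m _ hm
        rcases lt_or_gt_of_ne hm with h | h
        · have hmk : (m : ℕ) < k := by rw [← hκ]; exact h
          rw [(ih m hmk m rfl).1 κ (Ne.symm hm), zero_mul]
        · rw [hv κ m h, zero_mul]
      · intro h; exact absurd (Finset.mem_univ κ) h
    have hc1 : ∑ i, v i κ * v i κ = 1 := by
      have h := congrFun (congrFun hQ κ) κ
      rw [mul_apply] at h
      simp only [transpose_apply, one_apply_eq, hcol] at h
      exact h
    have hr1 : ∑ i, u κ i * u κ i = 1 := by
      have h := congrFun (congrFun hQ' κ) κ
      rw [mul_apply] at h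
      simp only [transpose_apply, one_apply_eq, hrow] at h
      exact h
    constructor
    · intro i hi
      have hsplit := Finset.sum_erase_add Finset.univ (fun i => v i κ * v i κ) (Finset.mem_univ κ)
      rw [hc1, hvd, mul_one] at hsplit
      have hz : ∑ i ∈ Finset.univ.erase κ, v i κ * v i κ = 0 := by linarith
      have h0 := (Finset.sum_eq_zero_iff_of_nonneg (fun i _ => mul_self_nonneg (v i κ))).1 hz i
        (Finset.mem_erase.2 ⟨hi, Finset.mem_univ i⟩)
      exact mul_self_eq_zero.1 h0
    · intro i hi
      have hsplit := Finset.sum_erase_add Finset.univ (fun i => u κ i * u κ i) (Finset.mem_univ κ)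
      rw [hr1, hud, mul_one] at hsplit
      have hz : ∑ i ∈ Finset.univ.erase κ, u κ i * u κ i = 0 := by linarith
      have h0 := (Finset.sum_eq_zero_iff_of_nonneg (fun i _ => mul_self_nonneg (u κ i))).1 hz i
        (Finset.mem_erase.2 ⟨hi, Finset.mem_univ i⟩)
      exact mul_self_eq_zero.1 h0
  constructor
  · ext i k
    by_cases hik : i = k
    · subst hik; rw [hvd, one_apply_eq]
    · rw [one_apply_ne hik]
      exact (key k k rfl).1 i hik
  · ext i k
    by_cases hik : i = k
    · subst hik; rw [hud, one_apply_eq]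
    · rw [one_apply_ne hik]
      exact (key i i rfl).2 k (Ne.symm hik)

/-! ### 5. The theorem -/

/-- **The weighted-torus TPP triple, every `n`.**  `c` strictly decreasing; `v` unit lower
triangular, `u` unit upper triangular, `x` on the torus hyperplane `∑ cᵢ xᵢ = 0`, `k` real
orthogonal: `v · diag(exp x) · u · k = 1` forces `v = 1`, `x = 0`, `u = 1`, `k = 1`.  This is the
triple product property of the closed subgroups `(T_c U⁻, U⁺, O(n))` of `GL_n(ℝ)` (dimensions
`n(n−1)/2 + n − 1`, `n(n−1)/2`, `n(n−1)/2`), whence BCGPU's Lie exponent satisfies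
`ω(GL(n,ℝ)) ≤ 3n/(n−1)` and `ω(SL(n,ℝ)) ≤ 3(n−1)/(n−2)`: the Lie exponent of `SL(n,ℝ)` is finite
(BCGPU 2022 = arXiv:2204.03826, Def. 4.1, question of §5). [new] -/
theorem soloLie_tpp_weightedTorus (n : ℕ) (c : Fin n → ℝ) (hc : StrictAnti c)
    (v u k : Matrix (Fin n) (Fin n) ℝ) (x : Fin n → ℝ)
    (hvd : ∀ i, v i i = 1) (hv : ∀ i j : Fin n, i < j → v i j = 0)
    (hud : ∀ i, u i i = 1) (hu : ∀ i j : Fin n, j < i → u i j = 0)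
    (hx : ∑ i, c i * x i = 0) (hk : kᵀ * k = 1)
    (h : v * diagonal (fun i => Real.exp (x i)) * u * k = 1) :
    v = 1 ∧ x = 0 ∧ u = 1 ∧ k = 1 := by
  set D : Matrix (Fin n) (Fin n) ℝ := diagonal (fun i => Real.exp (x i)) with hD
  set Q : Matrix (Fin n) (Fin n) ℝ := v * D * u with hQdef
  have hkQ : k * Q = 1 := mul_eq_one_comm.mp h
  have hkkT : k * kᵀ = 1 := mul_eq_one_comm.mp hk
  have hQeq : Q = kᵀ := by
    calc Q = (kᵀ * k) * Q := by rw [hk, Matrix.one_mul]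
      _ = kᵀ * (k * Q) := by rw [Matrix.mul_assoc]
      _ = kᵀ := by rw [hkQ, Matrix.mul_one]
  have hQQ : Qᵀ * Q = 1 := by rw [hQeq, transpose_transpose]; exact hkkT
  -- (1)+(2): every partial sum of `x` is `≤ 0`
  have hPj : ∀ j (hj : j ≤ n), ∑ i : Fin j, x (Fin.castLE hj i) ≤ 0 := by
    intro j hj
    have h1 := soloLie_abs_det_submatrix_le_one hj Q hQQ
    rw [hQdef, hD, soloLie_det_submatrix_vdu hj v u _ hvd hv hud hu, ← Real.exp_sum,
      abs_of_pos (Real.exp_pos _)] at h1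
    exact Real.exp_le_one_iff.mp h1
  -- the full sum vanishes: `det Q = ±1`
  have hdetQ : Q.det = Real.exp (∑ i, x i) := by
    rw [hQdef, hD, det_mul, det_mul, det_diagonal, Matrix.det_of_lowerTriangular v ?_,
      Matrix.det_of_upperTriangular ?_]
    · simp [hvd, hud, Real.exp_sum]
    · intro a b hab; exact hu _ _ hab
    · intro a b hab; exact hv _ _ (OrderDual.toDual_lt_toDual.mp hab)
  have hPn : ∑ i, x i = 0 := by
    have h1 : Q.det * Q.det = 1 := by
      have h2 := congrArg Matrix.det hQQ
      rwa [det_mul, det_transpose, det_one] at h2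
    rw [hdetQ] at h1
    rcases mul_self_eq_one_iff.mp h1 with h2 | h2
    · exact (Real.exp_eq_one_iff _).mp h2
    · linarith [Real.exp_pos (∑ i, x i)]
  -- (3): Abel summation, transported to `ℕ`-indexed sequences
  have hx0 : x = 0 := by
    let x' : ℕ → ℝ := fun i => if h : i < n then x ⟨i, h⟩ else 0
    let c' : ℕ → ℝ := fun i => if h : i < n then c ⟨i, h⟩ else 0
    have hP' : ∀ m, m < n → ∑ i ∈ range m, x' i ≤ 0 := by
      intro m hm
      have e : ∑ i ∈ range m, x' i = ∑ i : Fin m, x (Fin.castLE hm.le i) := by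
        rw [← Fin.sum_univ_eq_sum_range]
        refine Finset.sum_congr rfl fun i _ => ?_
        simp only [x', dif_pos (lt_of_lt_of_le i.isLt hm.le)]
        rfl
      rw [e]; exact hPj m hm.le
    have hxe : ∀ i : Fin n, x' i = x i := fun i => by
      simp only [x', dif_pos i.isLt]
    have hce : ∀ i : Fin n, c' i = c i := fun i => by
      simp only [c', dif_pos i.isLt]
    have hPn' : ∑ i ∈ range n, x' i = 0 := by
      rw [← Fin.sum_univ_eq_sum_range, ← hPn]
      exact Finset.sum_congr rfl fun i _ => hxe i
    have hcx' : ∑ i ∈ range n, c' i * x' i = 0 := by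
      rw [← Fin.sum_univ_eq_sum_range (fun i => c' i * x' i), ← hx]
      exact Finset.sum_congr rfl fun i _ => by rw [hxe, hce]
    have hc' : ∀ i, i + 1 < n → c' (i + 1) < c' i := by
      intro i hi
      simp only [c', dif_pos hi, dif_pos (Nat.lt_of_succ_lt hi)]
      exact hc (Fin.mk_lt_mk.2 (Nat.lt_succ_self i))
    have hz := soloLie_abel_range n c' x' hc' hP' hPn' hcx'
    funext i
    have h1 := hz i i.isLt
    rw [hxe] at h1
    exact h1
  -- (4): `D = 1`, `Q = v u` orthogonal, rigidity
  have hD1 : D = 1 := by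
    rw [hD, hx0]
    simp
  have hQvu : Q = v * u := by rw [hQdef, hD1, Matrix.mul_one]
  rw [hQvu] at hQQ
  obtain ⟨hv1, hu1⟩ := soloLie_vu_orthogonal_eq_one v u hvd hv hud hu hQQ
  have hk1 : k = 1 := by
    have hQ1 : Q = 1 := by rw [hQvu, hv1, hu1, Matrix.mul_one]
    rw [hQ1, Matrix.mul_one] at hkQ
    exact hkQ
  exact ⟨hv1, hx0, hu1, hk1⟩

end Summit.MatrixMultiplication.MatrixMultiplication.Theorems
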